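import Summits.HodgeConjecture.HodgeConjecture.Theorems.PeriodDeficiencyQbarGenericIsHodgeGenericCoverFact
import Summits.HodgeConjecture.HodgeConjecture.Theorems.PeriodDeficiencyQbarGenericIsHodgeGenericCoreOverFixedField
import Summits.HodgeConjecture.HodgeConjecture.Theorems.PeriodDeficiencyQbarGenericIsHodgeGenericStubMtRankEqOfTensorComparison
import Summits.HodgeConjecture.HodgeConjecture.Theorems.PeriodDeficiencyQbarGenericIsHodgeGenericStubConjugateComparisonOfNonemptyIso

/-!
# Skeleton of the crux `QbarGenericIsHodgeGeneric` (stmt-HodgeConjecture-11595), route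
# `PeriodDeficiency`, line `birth` (registered as `registered`) — reshape r6 by lead c3 (2026-08-17)

The crux HGQ (`Summit.HodgeConjecture.HodgeConjecture.Theses.PeriodDeficiency.QbarGenericIsHodgeGeneric`):
for the classical Betti–Hodge datum `B`, every smooth projective `ℚ̄`-family `f = f₀ ⊗_σ ℂ : 𝒳 → S`
over a smooth irreducible `ℚ̄`-scheme, every degree `i`, every geometric VHS datum `D` and every
`s ∈ S(ℂ)`, the point `s` is Hodge-generic (`dim MT` maximal) in its `ℚ̄`-Zariski closure `W(s)`.

**Everything the line proved before this lead is IN THE TREE** (sorry-free, `--supports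
stmt-HodgeConjecture-11595`; see `Cruxes/QbarGenericIsHodgeGeneric/WAVES.md`): leads 1 / c1 / c2
(reshapes r1–r5) landed p147691, p147844, p151911, p151655 (+ Literature p151399), p154941, p155949,
p156228, p156821 `…Reduction`, p157349 `…Core`, Literature p154148 (r4 fact), p160542, p160577,
p160729, Literature p161402 (r5 fact `Motives.cdk1995_nonHodgeGenericLocus_countableCover`),
p161842 + p162023 `…CoverFact`, p166050 `…CoverFactConverse`, p161713 `…CoreOverFixedField`.
After r5 the skeleton was closed modulo exactly two registered stubs: (ii-b) the family-free OPEN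
CORE `dim MT(Hⁱ(X^τ)) = dim MT(Hⁱ(X))` (≡ the crux modulo known mathematics) and (iv'-a) the printed
Cattani–Deligne–Kaplan cover fact (≡ the named Literature fact, `Iff.rfl`).

## Reshape r6 (this lead): the open core is split at its real seam

On paper (ii-b) follows from two things of very different status, which the tree could not tell
apart inside one `sorry`:

1. the **conjugate comparison** `Hⁱ(X^an, ℂ) ≅ Hⁱ((X^τ)^an, ℂ)` (Serre GAGA + algebraic de Rham base
   change, or Artin's comparison with étale cohomology; Charles–Schnell §11.2.5 eq. (11.2.3) and
   footnote 2: a `ℂ`-LINEAR isomorphism exists, a `ℚ`-rational one does not in general — Serre 1964,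
   Charles 2009, the catalogued barrier `Literature/Barriers/HodgeConjecture/ConjugateVarieties`) —
   classical, but absent from the tree (no algebraic de Rham / étale cohomology; even
   `bᵢ(X^τ) = bᵢ(X)` is not provable today);
2. **Deligne's "Hodge classes are absolute Hodge"** for the Hodge TENSORS of `Hⁱ(X)` (LNM 900, I §2,
   Conj./"espoir" 2.4 there called the main open question; Charles–Schnell Conj. 11.2.17): the
   comparison of 1. carries rational Hodge tensors of `X` to rational Hodge tensors of `X^τ` — OPEN in
   general, a THEOREM for abelian varieties (Deligne 1982, I Thm. 2.11) and for `H²` of hyperkähler /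
   K3-type varieties (André 1996, Thm. 0.6.2).

Reshape r6 derives (ii-b) (`mtRank_hodge_conjugateVariety_of_stubs`, proved below) from

* **S1 `stub_conjugateComparison_hodgeTensors`** (OPEN, the lead's stub) — the Betti shadow of 1.+2.:
  for `B` classical, `τ ∈ Aut(ℂ)`, `X` smooth projective: there is a `ℂ`-linear
  `ψ : ℂ ⊗ Hⁱ(X) ≃ ℂ ⊗ Hⁱ(X^τ)` whose tensor functoriality `T^{a,b}_ℂ ψ = ψ^{⊗a} ⊗ (ψ⁻ᵀ)^{⊗b}` carries
  the `ℂ`-span of the weight-`0` Hodge tensors of `Hⁱ(X)` in `T^{a,b}` onto that of `Hⁱ(X^τ)`, for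
  every `(a, b)` with `(a - b) i = 0` (from Deligne's canonical `τ`-semilinear comparison `φ_τ` one
  takes `ψ = φ_τ ∘ (τ⁻¹ ⊗ 1)`; stated for ALL `τ ∈ Aut(ℂ)`, as Deligne's conjecture is);
* **S2 `stub_mtRank_eq_of_tensorComparison`** (LANDED p173727 + helper p173418; pure linear algebra over the tree's
  `HodgeTensor` / `AtypicalHodgeLocus` vocabulary; Deligne 1982 I Prop. 2.9-type transport): such a `ψ`
  between ANY two finite-dimensional Hodge structures `H, H'` of the same weight forces
  `H.mtRank = H'.mtRank` — `Ad ψ` carries the complexified annihilator `ℂ ⊗ 𝔪𝔱(H)` (flat base change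
  of the annihilator of the rational Hodge tensors: `homBaseChange_bijective`,
  `piTensorBaseChange_bijective`, `dualBaseChange_injective`, a `ℚ`-basis of `ℂ`) onto `ℂ ⊗ 𝔪𝔱(H')`
  by `Ad ψ`-equivariance of the `ℂ`-linear derivation action (the `ℂ`-version of
  `tensorSpaceCongr_tensorSpaceDeriv`);
* **S3 `stub_conjugateComparison_of_nonempty_iso`** (LANDED p174153; the boundary of S1): S1 holds whenever
  `X^τ ≅ X` over `ℂ` (e.g. `τ` fixes a field of definition — every `X` definable over `ℚ̄` when
  `τ ∈ Aut(ℂ/ℚ̄)`): `ψ = (e^*)_ℂ` for the rational pull-back `e^* : Hⁱ(X) ≃ Hⁱ(X^τ)`, a morphism of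
  Hodge structures (`hodge_eq_comapEquiv_of_iso`, `tensorSpace_comapEquiv`, `comapEquiv_hodgeClasses`,
  naturality of the comparison maps `piTensorBaseChange_map_baseChange`,
  `dualBaseChange_symm_dualMap_baseChange`). With S2 it re-proves c2's boundary theorem
  `Theorems.mtRank_hodge_conjugateVariety_of_nonempty_iso` through the new seam (recorded below).

(iv'-a) `stub_nonGenericLocus_cover` is unchanged (≡ the named fact). Registered stubs after r6:
S1, S2, S3, (iv'-a) — S2 and S3 LANDED in wave 1 (p173727/p173418, p174153), so the skeleton is again
closed modulo exactly {S1 (open), (iv'-a) (named fact)}; the composition `QbarGenericIsHodgeGeneric_of_stubs` concludes HGQ BY NAME and uses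
S1, S2, (iv'-a). The tight form of the open core remains (ii-b) itself (crux ⟹ (ii-b):
`Theorems.core_of_qbarGenericIsHodgeGeneric`); S1 is its natural literature parent (stronger).

History: planner skeleton `birth` (3 stubs) → lead 1 r1/r2 (6 stubs, 4 landed) → lead c1 r3/r4
(8 stubs, 6 landed) → lead c2 r5 (5 stubs, 3 landed; commits b0c85788, d9e3b157, d90ff4d0) → lead c3
r6 (this file).

## References
* [Deligne1982HodgeCycles] Deligne, LNM 900 (1982), I §2 (2.1, Prop. 2.9, Thm. 2.11), I §3 (Prop. 3.1, 3.4).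
* [CharlesSchnell2014Notes] Charles–Schnell, Notes on absolute Hodge classes, §11.2.2–11.2.5, Conj. 11.2.17.
* [Andre1996Motifs] André, Publ. Math. IHÉS 83 (1996), Thm. 0.6.2.
* [Serre1964Conjugate] Serre, C. R. Acad. Sci. 258 (1964); [Charles2009Conjugate] Charles, Crelle 630 (2009).
* [KlinglerOtwinowskaUrbanik2023] KOU, Ann. Sci. ÉNS 56 (2023), §1.2, Conj. 1.5.
* [BaldiKlinglerUllmo2024] BKU, Invent. Math. 235 (2024), Thm. 1.1, §3.2.
* [CattaniDeligneKaplan1995JAMS] CDK, JAMS 8 (1995), Thm. 1.1, Cor. 1.2.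
-/

noncomputable section

namespace Summit.HodgeConjecture.HodgeConjecture.Cruxes.QbarGenericIsHodgeGeneric.Birth

open scoped TensorProduct
open CategoryTheory AlgebraicGeometry
open Literature.AlgebraicGeometry.Motives Literature.AlgebraicGeometry.HodgeTheory
open Summit.HodgeConjecture.HodgeConjecture.Theses.PeriodDeficiency (QbarGenericIsHodgeGeneric)
open Summit.HodgeConjecture.HodgeConjecture.Theorems

/-- STUB S1 (OPEN — the Betti shadow of "the conjugate comparison carries Hodge tensors to Hodge
tensors") — **conjugate comparison matching Hodge tensors**: for `B` classical (so that `B.hodge hX i`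
IS the Hodge structure of `Hⁱ(X^an; ℚ)`), `τ ∈ Aut(ℂ)` and `X` smooth projective over `ℂ` with conjugate
`X^τ = conjugateVariety τ X` (smooth projective by `IsSmoothProjective.conjugateVariety_holds`), there is
a `ℂ`-linear isomorphism `ψ : ℂ ⊗_ℚ Hⁱ(X) ≃ ℂ ⊗_ℚ Hⁱ(X^τ)` such that for every tensor type `(a, b)` of
weight `0` (`(a - b) i = 0`) the `ℂ`-linear tensor functoriality
`T_ℂ^{a,b} ψ = ψ^{⊗a} ⊗ ((ψ⁻¹)^∨)^{⊗b}` (Mathlib `TensorProduct.congr` / `PiTensorProduct.congr` /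
`LinearEquiv.dualMap`) maps the `ℂ`-span of the Hodge tensors of `Hⁱ(X)` — the rational type-`(0,0)`
classes `t ∈ T^{a,b} Hⁱ(X)` (`(H.tensorSpace a b).hodgeClasses 0`), read in
`T_ℂ^{a,b}(ℂ ⊗ Hⁱ(X)) = (ℂ ⊗ Hⁱ(X))^{⊗a} ⊗_ℂ ((ℂ ⊗ Hⁱ(X))^∨)^{⊗b}` through the tree's comparison maps
`tensorBaseChange`, `piTensorBaseChange`, `dualBaseChange` — ONTO the `ℂ`-span of the Hodge tensors of
`Hⁱ(X^τ)`. On paper: Deligne's canonical `τ`-semilinear comparison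
`φ_τ : Hⁱ(X^an, ℂ) ≅ Hⁱ_dR(X/ℂ) ⊗_{ℂ,τ} ℂ ≅ Hⁱ_dR(X^τ/ℂ) ≅ Hⁱ((X^τ)^an, ℂ)` (classical: GAGA + base
change; Charles–Schnell (11.2.3)) composed with `τ⁻¹ ⊗ 1` is `ℂ`-linear and agrees with `φ_τ` on
rational tensors; "`φ_τ` maps rational Hodge tensors to rational Hodge tensors" is Deligne's principal
open question (LNM 900 I §2; Charles–Schnell Conj. 11.2.17) — a theorem for abelian varieties (Deligne
1982 I Thm. 2.11, all degrees: `Hⁱ = ΛⁱH¹`) and for `H²` of K3-type varieties (André 1996 Thm. 0.6.2).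
Hence OPEN in general; TRUE when `X^τ ≅ X` (`stub_conjugateComparison_of_nonempty_iso`). Why it might
fail: a Hodge tensor of some `X` whose conjugate is not Hodge — which with HC gives a non-algebraic Hodge
class, i.e. ¬HC (Voisin 2007 Thm. 0.5(2) circle of ideas). Stronger than (ii-b), which it implies by S2.
[cite: Deligne1982HodgeCycles, I §2 (2.1, Prop. 2.9, Thm. 2.11)] [cite: CharlesSchnell2014Notes, §11.2.5
and Conj. 11.2.17] [cite: Andre1996Motifs, Thm. 0.6.2] -/
theorem stub_conjugateComparison_hodgeTensors :
    ∀ (B : BettiHodgeData ℂ), B.IsClassical → ∀ [HodgeTensorFacts.{0, 0}] (τ : ℂ ≃+* ℂ)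
      ⦃n : ℕ⦄ ⦃X : SchemeOver ℂ⦄ (hX : IsSmoothProjective n X) (i : ℕ) [Module.Finite ℚ (B.W.obj X i)]
      [Module.Finite ℚ (B.W.obj (conjugateVariety τ X) i)],
      ∃ ψ : ℂ ⊗[ℚ] B.W.obj X i ≃ₗ[ℂ] ℂ ⊗[ℚ] B.W.obj (conjugateVariety τ X) i,
        ∀ a b : ℕ, ((a : ℤ) - b) * ((i : ℤ)) = 0 →
          Submodule.map (TensorProduct.congr (PiTensorProduct.congr fun _ : Fin a => ψ)
              (PiTensorProduct.congr fun _ : Fin b => ψ.symm.dualMap)).toLinearMap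
            (Submodule.span ℂ ((fun t => ((TensorProduct.map (HodgeStructure.piTensorBaseChange (B.W.obj X i) (Fin a))
                ((PiTensorProduct.map fun _ : Fin b => HodgeStructure.dualBaseChange (B.W.obj X i)) ∘ₗ
                  HodgeStructure.piTensorBaseChange (Module.Dual ℚ (B.W.obj X i)) (Fin b))) ∘ₗ
              (HodgeStructure.tensorBaseChange (⨂[ℚ]^a (B.W.obj X i)) (⨂[ℚ]^b (Module.Dual ℚ (B.W.obj X i)))).toLinearMap)
              ((1 : ℂ) ⊗ₜ[ℚ] t)) '' (((B.hodge hX i).tensorSpace a b).hodgeClasses 0 : Set (hodgeTensorSpace (B.W.obj X i) a b)))) =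
          (Submodule.span ℂ ((fun t => ((TensorProduct.map (HodgeStructure.piTensorBaseChange (B.W.obj (conjugateVariety τ X) i) (Fin a))
                ((PiTensorProduct.map fun _ : Fin b => HodgeStructure.dualBaseChange (B.W.obj (conjugateVariety τ X) i)) ∘ₗ
                  HodgeStructure.piTensorBaseChange (Module.Dual ℚ (B.W.obj (conjugateVariety τ X) i)) (Fin b))) ∘ₗ
              (HodgeStructure.tensorBaseChange (⨂[ℚ]^a (B.W.obj (conjugateVariety τ X) i)) (⨂[ℚ]^b (Module.Dual ℚ (B.W.obj (conjugateVariety τ X) i)))).toLinearMap)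
              ((1 : ℂ) ⊗ₜ[ℚ] t)) '' (((B.hodge (IsSmoothProjective.conjugateVariety_holds τ hX) i).tensorSpace a b).hodgeClasses 0 : Set (hodgeTensorSpace (B.W.obj (conjugateVariety τ X) i) a b)))) := by
  sorry

/-- STUB S2 (LANDED p173727 — linear algebra) — **a `ℂ`-linear comparison matching the Hodge-tensor spans
forces equal Mumford–Tate rank**: for finite-dimensional `ℚ`-Hodge structures `H` on `V` and `H'` on
`V'` of the same weight `n` and a `ℂ`-linear `ψ : ℂ ⊗ V ≃ ℂ ⊗ V'` such that, for every `(a, b)` with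
`(a - b) n = 0`, `T_ℂ^{a,b} ψ` maps the `ℂ`-span of (the images under the comparison
`ℂ ⊗ T^{a,b} V → T_ℂ^{a,b}(ℂ ⊗ V)` of) the rational type-`(0,0)` tensors of `H` onto that of `H'`, one has
`H.mtRank = H'.mtRank` (`mtRank = dim_ℚ 𝔪𝔱`, `𝔪𝔱(H)` = the annihilator in `𝔤𝔩(V)` of the weight-`0`
type-`(0,0)` tensors under the derivation action `tensorSpaceDeriv`). Proof on paper (Deligne 1982 I
Prop. 3.1/3.4 + flat base change): (1) `dim_ℚ 𝔪𝔱(H) = dim_ℂ (ℂ ⊗ 𝔪𝔱(H))`; (2) under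
`homBaseChange : ℂ ⊗ End V ≅ End_ℂ(ℂ ⊗ V)` (`homBaseChange_bijective`), `ℂ ⊗ 𝔪𝔱(H)` is the
`ℂ`-annihilator `A(H)` of the comparison images of the rational Hodge tensors under the `ℂ`-linear
derivation action (naturality of the comparison maps for `⊆`; for `⊇` expand along a `ℚ`-basis of `ℂ`,
`TensorProduct.sum_tmul_basis_left_eq_zero`, using injectivity of the comparison —
`piTensorBaseChange_bijective`, `dualBaseChange_injective`); (3) `Ad ψ : End_ℂ(ℂ ⊗ V) ≅ End_ℂ(ℂ ⊗ V')`
maps `A(H)` onto `A(H')` because the `ℂ`-derivation action is `Ad`-equivariant,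
`T_ℂ ψ (ξ · s) = (ψ ξ ψ⁻¹) · T_ℂ ψ s` (the `ℂ`-version of `tensorSpaceCongr_tensorSpaceDeriv`), and
`T_ℂ ψ` matches the spans by hypothesis. [cite: Deligne1982HodgeCycles, I Prop. 3.1 and 3.4]
[cite: BaldiKlinglerUllmo2024, §3.2] -/
theorem stub_mtRank_eq_of_tensorComparison :
    ∀ [HodgeTensorFacts.{0, 0}] {V V' : Type} [AddCommGroup V] [Module ℚ V] [Module.Finite ℚ V]
      [AddCommGroup V'] [Module ℚ V'] [Module.Finite ℚ V'] {n : ℤ}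
      (H : HodgeStructure V n) (H' : HodgeStructure V' n) (ψ : ℂ ⊗[ℚ] V ≃ₗ[ℂ] ℂ ⊗[ℚ] V'),
      (∀ a b : ℕ, ((a : ℤ) - b) * (n) = 0 →
          Submodule.map (TensorProduct.congr (PiTensorProduct.congr fun _ : Fin a => ψ)
              (PiTensorProduct.congr fun _ : Fin b => ψ.symm.dualMap)).toLinearMap
            (Submodule.span ℂ ((fun t => ((TensorProduct.map (HodgeStructure.piTensorBaseChange (V) (Fin a))
                ((PiTensorProduct.map fun _ : Fin b => HodgeStructure.dualBaseChange (V)) ∘ₗ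
                  HodgeStructure.piTensorBaseChange (Module.Dual ℚ (V)) (Fin b))) ∘ₗ
              (HodgeStructure.tensorBaseChange (⨂[ℚ]^a (V)) (⨂[ℚ]^b (Module.Dual ℚ (V)))).toLinearMap)
              ((1 : ℂ) ⊗ₜ[ℚ] t)) '' (((H).tensorSpace a b).hodgeClasses 0 : Set (hodgeTensorSpace (V) a b)))) =
          (Submodule.span ℂ ((fun t => ((TensorProduct.map (HodgeStructure.piTensorBaseChange (V') (Fin a))
                ((PiTensorProduct.map fun _ : Fin b => HodgeStructure.dualBaseChange (V')) ∘ₗ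
                  HodgeStructure.piTensorBaseChange (Module.Dual ℚ (V')) (Fin b))) ∘ₗ
              (HodgeStructure.tensorBaseChange (⨂[ℚ]^a (V')) (⨂[ℚ]^b (Module.Dual ℚ (V')))).toLinearMap)
              ((1 : ℂ) ⊗ₜ[ℚ] t)) '' (((H').tensorSpace a b).hodgeClasses 0 : Set (hodgeTensorSpace (V') a b))))) →
      H.mtRank = H'.mtRank :=
  -- LANDED (wave 1 of lead c3): p173727, helper file …TensorComparisonTransport p173418
  _root_.Summit.HodgeConjecture.HodgeConjecture.Theorems.stub_mtRank_eq_of_tensorComparison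

/-- STUB S3 (LANDED p174153 — the boundary of S1) — **S1 holds whenever `X^τ ≅ X` over `ℂ`**: from a
`ℂ`-isomorphism `e : X^τ ≅ X` the pull-back `e^* : Hⁱ(X) ≃ Hⁱ(X^τ)` is an isomorphism of Hodge
structures (`hodge_eq_comapEquiv_of_iso`: `B.hodge (X^τ) = (B.hodge X).comapEquiv _`), its tensor
functoriality carries Hodge tensors onto Hodge tensors (`tensorSpace_comapEquiv`,
`comapEquiv_hodgeClasses`), and `ψ := (e^*)_ℂ` works because the comparison maps are natural in
rational linear maps (`piTensorBaseChange_map_baseChange`, `dualBaseChange_symm_dualMap_baseChange`,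
`tensorBaseChange_congr_baseChange`). In particular S1 holds for every `X` definable over a subfield
fixed by `τ` (`nonempty_iso_conjugateVariety_baseChangeHom_of_comp_eq`, p161713).
[cite: KlinglerOtwinowskaUrbanik2023, §1.2] -/
theorem stub_conjugateComparison_of_nonempty_iso :
    ∀ (B : BettiHodgeData ℂ) [HodgeTensorFacts.{0, 0}] (τ : ℂ ≃+* ℂ)
      ⦃n : ℕ⦄ ⦃X : SchemeOver ℂ⦄ (hX : IsSmoothProjective n X) (i : ℕ) [Module.Finite ℚ (B.W.obj X i)]
      [Module.Finite ℚ (B.W.obj (conjugateVariety τ X) i)], Nonempty (conjugateVariety τ X ≅ X) →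
      ∃ ψ : ℂ ⊗[ℚ] B.W.obj X i ≃ₗ[ℂ] ℂ ⊗[ℚ] B.W.obj (conjugateVariety τ X) i,
        ∀ a b : ℕ, ((a : ℤ) - b) * ((i : ℤ)) = 0 →
          Submodule.map (TensorProduct.congr (PiTensorProduct.congr fun _ : Fin a => ψ)
              (PiTensorProduct.congr fun _ : Fin b => ψ.symm.dualMap)).toLinearMap
            (Submodule.span ℂ ((fun t => ((TensorProduct.map (HodgeStructure.piTensorBaseChange (B.W.obj X i) (Fin a))
                ((PiTensorProduct.map fun _ : Fin b => HodgeStructure.dualBaseChange (B.W.obj X i)) ∘ₗ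
                  HodgeStructure.piTensorBaseChange (Module.Dual ℚ (B.W.obj X i)) (Fin b))) ∘ₗ
              (HodgeStructure.tensorBaseChange (⨂[ℚ]^a (B.W.obj X i)) (⨂[ℚ]^b (Module.Dual ℚ (B.W.obj X i)))).toLinearMap)
              ((1 : ℂ) ⊗ₜ[ℚ] t)) '' (((B.hodge hX i).tensorSpace a b).hodgeClasses 0 : Set (hodgeTensorSpace (B.W.obj X i) a b)))) =
          (Submodule.span ℂ ((fun t => ((TensorProduct.map (HodgeStructure.piTensorBaseChange (B.W.obj (conjugateVariety τ X) i) (Fin a))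
                ((PiTensorProduct.map fun _ : Fin b => HodgeStructure.dualBaseChange (B.W.obj (conjugateVariety τ X) i)) ∘ₗ
                  HodgeStructure.piTensorBaseChange (Module.Dual ℚ (B.W.obj (conjugateVariety τ X) i)) (Fin b))) ∘ₗ
              (HodgeStructure.tensorBaseChange (⨂[ℚ]^a (B.W.obj (conjugateVariety τ X) i)) (⨂[ℚ]^b (Module.Dual ℚ (B.W.obj (conjugateVariety τ X) i)))).toLinearMap)
              ((1 : ℂ) ⊗ₜ[ℚ] t)) '' (((B.hodge (IsSmoothProjective.conjugateVariety_holds τ hX) i).tensorSpace a b).hodgeClasses 0 : Set (hodgeTensorSpace (B.W.obj (conjugateVariety τ X) i) a b)))) :=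
  -- LANDED (wave 1 of lead c3): p174153
  _root_.Summit.HodgeConjecture.HodgeConjecture.Theorems.stub_conjugateComparison_of_nonempty_iso

/-- **(ii-b), the family-free open core of r4/r5, DERIVED from S1 and S2** (no longer a stub): for `B`
classical, `τ ∈ Aut(ℂ/σℚ̄)`, `X` smooth projective over `ℂ`, `dim MT(Hⁱ(X^τ)) = dim MT(Hⁱ(X))` —
S1 at the field automorphism underlying `τ` gives the comparison `ψ`, S2 turns it into equality of
Mumford–Tate ranks. This is the statement fed to `Theorems.qbarGenericIsHodgeGeneric_of_coverFact_of_core`.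
[cite: Deligne1982HodgeCycles, I §2 and Prop. 3.4] -/
theorem mtRank_hodge_conjugateVariety_of_stubs :
    ∀ (B : BettiHodgeData ℂ), B.IsClassical → ∀ [HodgeTensorFacts.{0, 0}]
      (σ : AlgebraicClosure ℚ →+* ℂ) (τ : ringAutOver σ) ⦃n : ℕ⦄ ⦃X : SchemeOver ℂ⦄
      (hX : IsSmoothProjective n X) (i : ℕ) [Module.Finite ℚ (B.W.obj X i)]
      [Module.Finite ℚ (B.W.obj (conjugateVariety
        (@AlgEquiv.toRingEquiv (AlgebraicClosure ℚ) ℂ ℂ _ _ _ σ.toAlgebra σ.toAlgebra τ) X) i)],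
      (B.hodge (IsSmoothProjective.conjugateVariety_holds
        (@AlgEquiv.toRingEquiv (AlgebraicClosure ℚ) ℂ ℂ _ _ _ σ.toAlgebra σ.toAlgebra τ) hX) i).mtRank =
        (B.hodge hX i).mtRank := by
  intro B hB _ σ τ n X hX i _ _
  obtain ⟨ψ, hψ⟩ := stub_conjugateComparison_hodgeTensors B hB
    (@AlgEquiv.toRingEquiv (AlgebraicClosure ℚ) ℂ ℂ _ _ _ σ.toAlgebra σ.toAlgebra τ) hX i
  exact (stub_mtRank_eq_of_tensorComparison _ _ ψ hψ).symm

/-- STUB (iv'-a) — **the non-Hodge-generic locus of a closed irreducible subvariety is covered, on an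
affine chart, by countably many strict closed subvarieties**: verbatim the named Literature fact
`Motives.cdk1995_nonHodgeGenericLocus_countableCover` (Cattani–Deligne–Kaplan 1995 Thm. 1.1 / Cor. 1.2
in the form of Baldi–Klingler–Ullmo 2024 Thm. 1.1 — `HL(S, 𝕍^⊗)` is a countable union of strict closed
irreducible algebraic subvarieties — for the restriction to a closed irreducible `Z ⊆ S`, BKU §3.2, via
a resolution and André 1992 §5, traced on an affine chart). Closing this stub = discharging that fact
(`stub_nonGenericLocus_cover_iff_fact`). [cite: BaldiKlinglerUllmo2024, Thm. 1.1 and §3.2]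
[cite: CattaniDeligneKaplan1995JAMS, Thm. 1.1 and Cor. 1.2] [cite: Andre1992, §5] -/
theorem stub_nonGenericLocus_cover :
    ∀ (B : BettiHodgeData ℂ), B.IsClassical → ∀ [HodgeTensorFacts.{0, 0}]
      ⦃𝒳 S : SchemeOver ℂ⦄ (f : 𝒳 ⟶ S) (n i : ℕ) (D : GeometricVHSData B f n i)
      [∀ s, Module.Finite ℚ (D.V.fiber s)],
      IrreducibleSpace S.left → AlgebraicGeometry.Smooth S.hom →
      ∀ U : S.left.Opens, IsAffineOpen U →
      ∀ Z : Set (ComplexPoints S), IsIrreducibleZariskiClosedOnPoints S Z → (∃ z ∈ Z, z.pt ∈ U) →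
        ∃ W : ℕ → Set (ComplexPoints S), (∀ k, IsZariskiClosedOnPoints S (W k) ∧ ¬ Z ⊆ W k) ∧
          ∀ z ∈ Z, z.pt ∈ U → D.mtRankAt z < D.genericMTRank Z → ∃ k, z ∈ W k := by
  sorry

/-- (iv'-a) and the named fact agree by `Iff.rfl`. [cite: BaldiKlinglerUllmo2024, Thm. 1.1 and §3.2] -/
theorem stub_nonGenericLocus_cover_iff_fact :
    (∀ (B : BettiHodgeData ℂ), B.IsClassical → ∀ [HodgeTensorFacts.{0, 0}]
      ⦃𝒳 S : SchemeOver ℂ⦄ (f : 𝒳 ⟶ S) (n i : ℕ) (D : GeometricVHSData B f n i)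
      [∀ s, Module.Finite ℚ (D.V.fiber s)],
      IrreducibleSpace S.left → AlgebraicGeometry.Smooth S.hom →
      ∀ U : S.left.Opens, IsAffineOpen U →
      ∀ Z : Set (ComplexPoints S), IsIrreducibleZariskiClosedOnPoints S Z → (∃ z ∈ Z, z.pt ∈ U) →
        ∃ W : ℕ → Set (ComplexPoints S), (∀ k, IsZariskiClosedOnPoints S (W k) ∧ ¬ Z ⊆ W k) ∧
          ∀ z ∈ Z, z.pt ∈ U → D.mtRankAt z < D.genericMTRank Z → ∃ k, z ∈ W k) ↔
    cdk1995_nonHodgeGenericLocus_countableCover :=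
  Iff.rfl

/-- **THE LINE'S COMPOSITION — the crux, closed modulo the registered stubs S1, S2, (iv'-a)**:
`Theorems.qbarGenericIsHodgeGeneric_of_coverFact_of_core` (p161842) applied to (iv'-a) and to the open
core (ii-b) as derived from S1 + S2 (`mtRank_hodge_conjugateVariety_of_stubs`); concludes HGQ BY NAME.
[folklore] -/
theorem QbarGenericIsHodgeGeneric_of_stubs : QbarGenericIsHodgeGeneric :=
  qbarGenericIsHodgeGeneric_of_coverFact_of_core
    (stub_nonGenericLocus_cover_iff_fact.1 stub_nonGenericLocus_cover)
    mtRank_hodge_conjugateVariety_of_stubs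

/-- **Boundary through the new seam, recorded**: S3 + S2 re-prove c2's boundary theorem
`Theorems.mtRank_hodge_conjugateVariety_of_nonempty_iso` — the open core holds whenever `X^τ ≅ X`.
[folklore] -/
theorem mtRank_hodge_conjugateVariety_of_nonempty_iso_of_stubs (B : BettiHodgeData ℂ)
    [HodgeTensorFacts.{0, 0}] (τ : ℂ ≃+* ℂ) ⦃n : ℕ⦄ ⦃X : SchemeOver ℂ⦄ (hX : IsSmoothProjective n X)
    (i : ℕ) [Module.Finite ℚ (B.W.obj X i)] [Module.Finite ℚ (B.W.obj (conjugateVariety τ X) i)]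
    (he : Nonempty (conjugateVariety τ X ≅ X)) :
    (B.hodge (IsSmoothProjective.conjugateVariety_holds τ hX) i).mtRank = (B.hodge hX i).mtRank := by
  obtain ⟨ψ, hψ⟩ := stub_conjugateComparison_of_nonempty_iso B τ hX i he
  exact (stub_mtRank_eq_of_tensorComparison _ _ ψ hψ).symm

/-- **Tightness, recorded** (unchanged from r5): the crux implies the open core (ii-b), given the
named spreading-out fact and the existence of geometric VHS data
(`Theorems.core_of_qbarGenericIsHodgeGeneric`). [folklore] -/
theorem mtRank_hodge_conjugateVariety_of_crux
    (hsp : spreadingOut_smoothProjective_qbarFamily)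
    (hex : ∀ (B : BettiHodgeData ℂ), B.IsClassical → ∀ (σ : AlgebraicClosure ℚ →+* ℂ)
      ⦃𝒳₀ S₀ : SchemeOver (AlgebraicClosure ℚ)⦄ (f₀ : 𝒳₀ ⟶ S₀) (n i : ℕ),
      IsSmoothProjectiveFamily ((baseChangeHom σ).map f₀) n → IrreducibleSpace S₀.left →
      AlgebraicGeometry.Smooth S₀.hom →
      ∃ D : GeometricVHSData B ((baseChangeHom σ).map f₀) n i, ∀ s, Module.Finite ℚ (D.V.fiber s))
    (h : QbarGenericIsHodgeGeneric) :
    ∀ (B : BettiHodgeData ℂ), B.IsClassical → ∀ [HodgeTensorFacts.{0, 0}]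
      (σ : AlgebraicClosure ℚ →+* ℂ) (τ : ringAutOver σ) ⦃n : ℕ⦄ ⦃X : SchemeOver ℂ⦄
      (hX : IsSmoothProjective n X) (i : ℕ) [Module.Finite ℚ (B.W.obj X i)]
      [Module.Finite ℚ (B.W.obj (conjugateVariety
        (@AlgEquiv.toRingEquiv (AlgebraicClosure ℚ) ℂ ℂ _ _ _ σ.toAlgebra σ.toAlgebra τ) X) i)],
      (B.hodge (IsSmoothProjective.conjugateVariety_holds
        (@AlgEquiv.toRingEquiv (AlgebraicClosure ℚ) ℂ ℂ _ _ _ σ.toAlgebra σ.toAlgebra τ) hX) i).mtRank =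
        (B.hodge hX i).mtRank :=
  core_of_qbarGenericIsHodgeGeneric hsp hex h

/-- **Boundary of (ii-b), recorded** (unchanged from r5): the open core holds at every `X` definable
over `ℚ̄` (`Theorems.mtRank_hodge_conjugateVariety_of_qbarModel`, p161713).
[cite: KlinglerOtwinowskaUrbanik2023, §1.2 and Conj. 1.5(a)] -/
theorem mtRank_hodge_conjugateVariety_of_qbarModel' :
    ∀ (B : BettiHodgeData ℂ) [HodgeTensorFacts.{0, 0}] (σ : AlgebraicClosure ℚ →+* ℂ)
      (τ : ringAutOver σ) (X₀ : SchemeOver (AlgebraicClosure ℚ)) ⦃n : ℕ⦄ ⦃X : SchemeOver ℂ⦄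
      (_ : X ≅ (baseChangeHom σ).obj X₀) (hX : IsSmoothProjective n X) (i : ℕ)
      [Module.Finite ℚ (B.W.obj X i)]
      [Module.Finite ℚ (B.W.obj (conjugateVariety
        (@AlgEquiv.toRingEquiv (AlgebraicClosure ℚ) ℂ ℂ _ _ _ σ.toAlgebra σ.toAlgebra τ) X) i)],
      (B.hodge (IsSmoothProjective.conjugateVariety_holds
        (@AlgEquiv.toRingEquiv (AlgebraicClosure ℚ) ℂ ℂ _ _ _ σ.toAlgebra σ.toAlgebra τ) hX) i).mtRank =
        (B.hodge hX i).mtRank :=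
  mtRank_hodge_conjugateVariety_of_qbarModel

end Summit.HodgeConjecture.HodgeConjecture.Cruxes.QbarGenericIsHodgeGeneric.Birth

end
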